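import Summits.BirchSwinnertonDyer.BirchSwinnertonDyer.Theorems.ResidualThetaTransportAtTwoSignedMuSeedAtTwoPlusSmoothingCoboundary
import Summits.BirchSwinnertonDyer.BirchSwinnertonDyer.Theorems.ResidualThetaTransportAtTwoSignedMuSeedAtTwoPlusSmoothingCoboundaryOrbit
import Summits.BirchSwinnertonDyer.BirchSwinnertonDyer.Theorems.ResidualThetaTransportAtTwoSignedMuSeedAtTwoPlusJetRhoSymmetrisation
import HarnessLib

/-!
# Smoothing coboundary VIII — level `0` assembled: the field dichotomy (coboundary unless `η ≡ 1`), the orbit functional as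
# `S₀ + ω S₁ + ω² S₂` over the three cosets of `ker χ̄₀`, and the character-free rung-R0 criterion
# «both twists `χ₀^{±1}` silent at level 0 ⟺ the three coset sums are equal»
# (seed crux `SignedMuSeedAtTwoPlus` stmt-BirchSwinnertonDyer-21438; parent Kμ⁺ stmt-BirchSwinnertonDyer-20689, route
# ResidualThetaTransportAtTwo; line card `Cruxes/SignedMuSeedAtTwoPlus/Lines/smoothing-coboundary.md`, CS3 and CS7/R0)

Cell `bsd-wall`, width seat `bsd-wall-rtt-p4-w2` g15 (`--supports`, closes nothing).  THEOREMS ONLY; BSD is not proved by this.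

* `cocycle_additive_of_forall_eq_one`, **`coboundaryLaw_of_exists_ne_one`** — over a field: a twisted cocycle is additive if
  `η ≡ 1`, and a coboundary as soon as ONE `η b₀ ≠ 1` (the card's «take `β ≡ 1 (mod 2)` with `χ₀(β) ≠ 1`»);
* `one_ne_omega`, `omega_ne_omega_sq`, `one_ne_omega_sq` — the three cube roots of unity are distinct in a domain of
  characteristic `2` (`ω² + ω + 1 = 0`; `ω³ = 1` is `JetCharacterSums.pow_three_eq_one_of_rho`);
* **`orbitSum_eq_cosetSums`**, **`orbitSum_inv_eq_cosetSums`** — for a character `χ` with values in `{1, ω, ω²}` (the cubic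
  `χ̄₀` of the `S₃`-sextic), `Σ_c χ c·g c = S₀ + ω S₁ + ω² S₂` and `Σ_c χ c⁻¹·g c = S₀ + ω² S₁ + ω S₂` with
  `S_i = Σ_{χ c = ωⁱ} g c` the COSET SUMS (`Finset.sum_filter` bookkeeping);
* **`levelZero_bothSilent_iff_cosetSums_eq`** — rung R0, character-free: if the two twisted orbit functionals at a fixed `α`
  are the values of coboundaries `κ_±·(η_±(α) − 1)` with `η_±(α) ≠ 1`, then `κ₊ = 0 ∧ κ₋ = 0 ⟺ S₀ = S₁ = S₂`
  (`apply_eq_zero_iff` + `twistedSums_eq_zero_iff`); with the trivial-twist vanishing `S₀ + S₁ + S₂ = 0` also `⟺ S₀ = S₁ = S₂ = 0`.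

[folklore]
-/

set_option autoImplicit false
-- the Theorems namespace of this sub repeats the summit name by design (D-0017 nested layout)
set_option linter.dupNamespace false

open Finset

namespace Summit.BirchSwinnertonDyer.BirchSwinnertonDyer.Theorems.SignedMuAtTwo.SmoothingCoboundary

/-! ## The field dichotomy -/

section Field

variable {M R : Type*} [CommMonoid M]

/-- If the multiplier is trivial (`η ≡ 1`) a twisted cocycle is an additive function `f (a*b) = f a + f b`. [folklore] -/
theorem cocycle_additive_of_forall_eq_one [CommRing R] (η : M →* R) (f : M → R)
    (hf : ∀ a b, f (a * b) = f b + η b * f a) (h1 : ∀ b, η b = 1) (a b : M) : f (a * b) = f a + f b := by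
  rw [hf, h1, one_mul, add_comm]

/-- **Over a field, a twisted cocycle with ONE `η b₀ ≠ 1` is a coboundary** `f a = κ·(η a − 1)`. [folklore] -/
theorem coboundaryLaw_of_exists_ne_one [Field R] (η : M →* R) (f : M → R)
    (hf : ∀ a b, f (a * b) = f b + η b * f a) (hb : ∃ b₀, η b₀ ≠ 1) : ∃ κ : R, ∀ a, f a = κ * (η a - 1) := by
  obtain ⟨b₀, hb₀⟩ := hb
  exact coboundaryLaw η f hf ⟨b₀, (sub_ne_zero.mpr hb₀).isUnit⟩

end Field

/-! ## The three cube roots of unity in characteristic `2` -/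

section CubeRoots

variable {R : Type*} [CommRing R] [IsDomain R] [CharP R 2] {ω : R} (hω : ω ^ 2 + ω + 1 = 0)
include hω

/-- `1 ≠ ω` (else `3 = 0`, impossible in characteristic `2`). [folklore] -/
theorem one_ne_omega : (1 : R) ≠ ω := by
  intro h
  have h2 : (2 : R) = 0 := CharTwo.two_eq_zero
  have : (1 : R) = 0 := by
    rw [← h] at hω
    linear_combination hω - h2
  exact one_ne_zero this

/-- `ω ≠ ω²`. [folklore] -/
theorem omega_ne_omega_sq : ω ≠ ω ^ 2 := by
  intro h
  have h2 : (2 : R) = 0 := CharTwo.two_eq_zero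
  have : (1 : R) = 0 := by linear_combination hω + h - ω * h2
  exact one_ne_zero this

/-- `1 ≠ ω²`. [folklore] -/
theorem one_ne_omega_sq : (1 : R) ≠ ω ^ 2 := by
  intro h
  have h2 : (2 : R) = 0 := CharTwo.two_eq_zero
  have : ω = 1 := by
    have h3 := JetCharacterSums.pow_three_eq_one_of_rho hω
    calc ω = ω ^ 3 := by
            rw [show (3 : ℕ) = 1 + 2 from rfl, pow_add, pow_one, ← h, mul_one]
      _ = 1 := h3
  exact one_ne_omega hω this.symm

end CubeRoots

/-! ## The orbit functional as a combination of the three coset sums -/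

section CosetSums

variable {R G : Type*} [CommRing R] [IsDomain R] [CharP R 2] {ω : R} (hω : ω ^ 2 + ω + 1 = 0)
  [CommGroup G] [Fintype G] [DecidableEq R] (χ : G →* R) (g : G → R)
include hω

/-- **The orbit functional over the three cosets**: for a character `χ` with values in `{1, ω, ω²}`,
`Σ_c χ c·g c = S₀ + ω·S₁ + ω²·S₂` with `S_i := Σ_{c : χ c = ωⁱ} g c`. [folklore] -/
theorem orbitSum_eq_cosetSums (hval : ∀ c, χ c = 1 ∨ χ c = ω ∨ χ c = ω ^ 2) :
    ∑ c, χ c * g c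
      = (∑ c ∈ univ.filter (fun c => χ c = 1), g c) + ω * (∑ c ∈ univ.filter (fun c => χ c = ω), g c)
          + ω ^ 2 * (∑ c ∈ univ.filter (fun c => χ c = ω ^ 2), g c) := by
  have h01 := one_ne_omega hω
  have h12 := omega_ne_omega_sq hω
  have h02 := one_ne_omega_sq hω
  -- split the universe into the three (disjoint) fibres
  have hsplit : ∀ c, χ c * g c = (if χ c = 1 then g c else 0) + ω * (if χ c = ω then g c else 0)
      + ω ^ 2 * (if χ c = ω ^ 2 then g c else 0) := by
    intro c
    rcases hval c with h | h | h <;> rw [h]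
    · rw [if_pos rfl, if_neg h01, if_neg h02]; ring
    · rw [if_neg (Ne.symm h01), if_pos rfl, if_neg h12]; ring
    · rw [if_neg (Ne.symm h02), if_neg (Ne.symm h12), if_pos rfl]; ring
  simp_rw [hsplit, sum_add_distrib, ← mul_sum, sum_ite, sum_const_zero, add_zero]

/-- The INVERSE character: `Σ_c χ c⁻¹·g c = S₀ + ω²·S₁ + ω·S₂` (`χ c⁻¹ = (χ c)²` on cube roots of unity). [folklore] -/
theorem orbitSum_inv_eq_cosetSums (hval : ∀ c, χ c = 1 ∨ χ c = ω ∨ χ c = ω ^ 2) :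
    ∑ c, χ c⁻¹ * g c
      = (∑ c ∈ univ.filter (fun c => χ c = 1), g c) + ω ^ 2 * (∑ c ∈ univ.filter (fun c => χ c = ω), g c)
          + ω * (∑ c ∈ univ.filter (fun c => χ c = ω ^ 2), g c) := by
  have h01 := one_ne_omega hω
  have h12 := omega_ne_omega_sq hω
  have h02 := one_ne_omega_sq hω
  have h3 := JetCharacterSums.pow_three_eq_one_of_rho hω
  have hinv : ∀ c, χ c⁻¹ = χ c ^ 2 := by
    intro c
    have hc3 : χ c ^ 3 = 1 := by
      rcases hval c with h | h | h <;> rw [h]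
      · exact one_pow 3
      · exact h3
      · rw [← pow_mul, show 2 * 3 = 3 * 2 from rfl, pow_mul, h3, one_pow]
    have hu : χ c⁻¹ * χ c = 1 := char_inv_mul_self χ c
    calc χ c⁻¹ = χ c⁻¹ * χ c ^ 3 := by rw [hc3, mul_one]
      _ = (χ c⁻¹ * χ c) * χ c ^ 2 := by ring
      _ = χ c ^ 2 := by rw [hu, one_mul]
  have hsplit : ∀ c, χ c⁻¹ * g c = (if χ c = 1 then g c else 0) + ω ^ 2 * (if χ c = ω then g c else 0)
      + ω * (if χ c = ω ^ 2 then g c else 0) := by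
    intro c
    rw [hinv c]
    rcases hval c with h | h | h <;> rw [h]
    · rw [if_pos rfl, if_neg h01, if_neg h02]; ring
    · rw [if_neg (Ne.symm h01), if_pos rfl, if_neg h12]; ring
    · rw [if_neg (Ne.symm h02), if_neg (Ne.symm h12), if_pos rfl]
      linear_combination g c * ω * h3
  simp_rw [hsplit, sum_add_distrib, ← mul_sum, sum_ite, sum_const_zero, add_zero]

end CosetSums

/-! ## Rung R0, character-free -/

section RungZero

variable {R : Type*} [CommRing R] [IsDomain R] [CharP R 2] {ω : R} (hω : ω ^ 2 + ω + 1 = 0)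
include hω

/-- **«Both twists silent at level 0 ⟺ the three coset sums are equal»** (rung R0 of the card, character-free form):
if the two twisted orbit functionals at the fixed smoothing element `α` are `S₀ + ωS₁ + ω²S₂ = κ₊·(η₊ − 1)` and
`S₀ + ω²S₁ + ωS₂ = κ₋·(η₋ − 1)` (coboundary law for `χ₀` and `χ₀⁻¹`, evaluated at `α`) with `η₊ ≠ 1`, `η₋ ≠ 1`
(`χ₀(α) ≠ 1`, so `η(α) ≠ 1` for BOTH twists), then `κ₊ = 0 ∧ κ₋ = 0 ⟺ S₀ = S₁ ∧ S₁ = S₂`. [folklore] -/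
theorem levelZero_bothSilent_iff_cosetSums_eq {S₀ S₁ S₂ κp κm ηp ηm : R}
    (hp : S₀ + ω * S₁ + ω ^ 2 * S₂ = κp * (ηp - 1)) (hm : S₀ + ω ^ 2 * S₁ + ω * S₂ = κm * (ηm - 1))
    (hηp : ηp ≠ 1) (hηm : ηm ≠ 1) : (κp = 0 ∧ κm = 0) ↔ (S₀ = S₁ ∧ S₁ = S₂) := by
  rw [← twistedSums_eq_zero_iff hω S₀ S₁ S₂, hp, hm, mul_eq_zero, mul_eq_zero, sub_eq_zero, sub_eq_zero,
    or_iff_left hηp, or_iff_left hηm]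

/-- The same together with the trivial-twist vanishing `S₀ + S₁ + S₂ = 0` (inert `q`): both twists silent ⟺ all three
coset sums vanish. [folklore] -/
theorem levelZero_bothSilent_iff_cosetSums_zero {S₀ S₁ S₂ κp κm ηp ηm : R} (h0 : S₀ + S₁ + S₂ = 0)
    (hp : S₀ + ω * S₁ + ω ^ 2 * S₂ = κp * (ηp - 1)) (hm : S₀ + ω ^ 2 * S₁ + ω * S₂ = κm * (ηm - 1))
    (hηp : ηp ≠ 1) (hηm : ηm ≠ 1) : (κp = 0 ∧ κm = 0) ↔ (S₀ = 0 ∧ S₁ = 0 ∧ S₂ = 0) := by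
  rw [← twistedSums_eq_zero_iff_of_sum_eq_zero hω S₀ S₁ S₂ h0, hp, hm, mul_eq_zero, mul_eq_zero, sub_eq_zero,
    sub_eq_zero, or_iff_left hηp, or_iff_left hηm]

end RungZero

end Summit.BirchSwinnertonDyer.BirchSwinnertonDyer.Theorems.SignedMuAtTwo.SmoothingCoboundary
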